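import Summits.FinalStateConjecture.FinalStateConjecture.Theses.SwallowTheDatum
import Literature.Geometry.Lorentzian.KerrDataProofs
import Literature.Geometry.Lorentzian.KerrSchildCoord
import Literature.Geometry.Lorentzian.KerrDataSchwarzschildExtrinsic

/-!
# Negative lemmas for the crux `SwallowTheDatum.ParametricKerrBurial`, III — the spinning
# Kerr–Schild slice on the rotation axis

Support file (refuter, cdisprove seat of `stmt-FinalStateConjecture-10052`, cycle 3; everything
proved, no definitions, no named facts). Parts I–II (`ZeroSpinShieldCurvature`,
`ZeroSpinBurialLimit`) read the crux's shielding predicate only for ZERO spin, through the closed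
forms `Kerr.hRep`/`Kerr.kRep` of the Schwarzschild Kerr–Schild slice. The tree has no closed form of
the slice data for `a ≠ 0`, but ON THE ROTATION AXIS everything is explicit, for every spin:

* `radius_axisPt` — at `x = (t; 0, 0, u)`, `u > 0`, the Kerr–Schild radius is `r = u` (the defining
  quartic factors as `(r² − u²)(r² + a²)`; `Kerr.radius_eq_of_quartic`); hence `H = M u/(u² + a²)`
  (`scalarH_axisPt`), `ℓ = dt* + dz =: ℓ₀` (`nullCovector_axisPt`), `ℓ♯ = −∂_{t*} + ∂_z`,
  `g = η + 2H ℓ₀ ⊗ ℓ₀` (`bilin_axisPt`), `V = −g♯dt* = (1 + 2H)∂_{t*} − 2H ∂_z` (`timeVector_axisPt`);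
* `fderiv_bilin_axis_Z` — **`∂_z g = 2H_ax′(u) ℓ₀ ⊗ ℓ₀` on the axis** (`ℓ ≡ ℓ₀` along the axis, so the
  line derivative along `∂_z` is that of the scalar profile `H_ax(u) = Mu/(u² + a²)`,
  `H_ax′ = M(a² − u²)/(u² + a²)²`; uniqueness of line derivatives); `∂_{t*} g = 0` is the tree's
  `Kerr.fderiv_bilin_basisVector_zero`;
* `eq_normalRepA` — **uniqueness of the future unit normal of the slice `{t* = 0}`, any spin**: a
  vector `g`-orthogonal to the slice, unit timelike and in the future cone of `V` IS `V/√(1 + 2H)`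
  (linear algebra: `g(V, ·) = −dt*` and `g|_{slice} = δ + 2H ℓ⃗ ⊗ ℓ⃗ ≥ δ`);
  `bilin_normalRepA_ofTimeSpace` (normality), `differentiableAt_normalRepA`,
  `bilin_fderiv_normalRepA` (the derivative of the normality relation along the slice,
  `g(DN v, w̃) = −(∂_{ṽ} g)(N, w̃)`, which eliminates the normal-derivative term of the second
  fundamental form), `normalRepA_axisPt` (the normal at the axis point).

Part IV (`GeneralSpinShieldTeeth`) evaluates the typed second fundamental form of every Kerr shield
at the axis test point `(0, 0, 3M)` in closed form and draws the consequences for the crux (every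
shield of every spin forces `k ≢ 0`; the guard `c ≠ 0` of the crux is load-bearing).

## References

* R. P. Kerr, PRL 11 (1963) 237, eq. (5); M. Visser, arXiv:0706.0622, (32)–(35). [arXiv07060622]
* G. B. Cook, *Initial data for numerical relativity*, Living Rev. Relativ. 3 (2000) 5, §3.2.2
  (Kerr–Schild slices: lapse `(1 + 2H)^{-1/2}`, shift `2Hℓⁱ/(1 + 2H)`). [Cook2000]
* B. O'Neill, *Semi-Riemannian geometry* (1983), Ch. 4, Lemma 4.4 (differentiating `⟨Z, W⟩ = 0`).
  [ONeill1983]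
-/

noncomputable section

-- instance search through nested operator types `E4 →L E4 →L E4 →L ℝ` (as in the tree files)
set_option maxSynthPendingDepth 3
-- `Summit.<S>.<S>.…` by design (D-0017; the Summits lakefile turns this linter off as well)
set_option linter.dupNamespace false

namespace Summit.FinalStateConjecture.FinalStateConjecture.Theorems.ParametricKerrBurial.Negative

open Literature.Geometry.Lorentzian
open scoped Manifold ContDiff Topology InnerProductSpace
open Set Filter

/-- The spatial unit vector `e_z ∈ E3` (local notation). -/
local notation "e_z" => (EuclideanSpace.single (2 : Fin 3) (1 : ℝ) : E3)

/-- The constant axis covector `ℓ₀ = dt* + dz` (local notation). -/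
local notation "ℓ₀" => (E4.covector ![(1 : ℝ), 0, 0, 1])

/-- The representative `y ↦ (1 + 2H(0,y))^{-1/2} V(0, y)` of the future unit normal of the
Kerr–Schild slice `{t* = 0}` of Kerr `(M, a)` (local notation; Cook 2000, §3.2.2). -/
local notation "νKS[" M ", " a "]" => (fun y : E3 ↦
  (√(1 + 2 * Kerr.scalarH M a (E4.ofTimeSpace 0 y)))⁻¹ • Kerr.timeVector M a (E4.ofTimeSpace 0 y))

/-! ### The Kerr–Schild objects at the axis points `(t; 0, 0, u)`, `u > 0` -/

/-- Components of the axis point `(0, 0, u) = u e_z ∈ E3`. [folklore] -/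
theorem axisPt_apply (u : ℝ) (i : Fin 3) : (u • e_z) i = if i = 2 then u else 0 := by
  fin_cases i <;> simp

/-- `‖u e_z‖ = u` for `u ≥ 0`. [folklore] -/
theorem norm_axisPt {u : ℝ} (hu : 0 ≤ u) : ‖u • e_z‖ = u := by
  rw [norm_smul, PiLp.norm_single, Real.norm_eq_abs, norm_one, mul_one, abs_of_nonneg hu]

/-- `x¹ = 0` at the axis point `(t; 0, 0, u)`. [folklore] -/
theorem ofTimeSpace_axisPt_apply_one (t u : ℝ) : E4.ofTimeSpace t (u • e_z) 1 = 0 := by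
  show E4.ofTimeSpace t (u • e_z) (Fin.succ 0) = 0
  rw [E4.ofTimeSpace_apply_succ, axisPt_apply]; simp

/-- `x² = 0` at the axis point `(t; 0, 0, u)`. [folklore] -/
theorem ofTimeSpace_axisPt_apply_two (t u : ℝ) : E4.ofTimeSpace t (u • e_z) 2 = 0 := by
  show E4.ofTimeSpace t (u • e_z) (Fin.succ 1) = 0
  rw [E4.ofTimeSpace_apply_succ, axisPt_apply]; simp

/-- `x³ = u` at the axis point `(t; 0, 0, u)`. [folklore] -/
theorem ofTimeSpace_axisPt_apply_three (t u : ℝ) : E4.ofTimeSpace t (u • e_z) 3 = u := by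
  show E4.ofTimeSpace t (u • e_z) (Fin.succ 2) = u
  rw [E4.ofTimeSpace_apply_succ, axisPt_apply]; simp

/-- **On the axis the Kerr–Schild radius is `|z|`**: `r(a, (t; 0, 0, u)) = u` for `u > 0`
(the defining quartic factors as `(r² − u²)(r² + a²)`). [folklore] -/
theorem radius_axisPt (a t : ℝ) {u : ℝ} (hu : 0 < u) :
    Kerr.radius a (E4.ofTimeSpace t (u • e_z)) = u := by
  apply Kerr.radius_eq_of_quartic hu
  rw [E4.spatialNorm_ofTimeSpace, norm_axisPt hu.le, ofTimeSpace_axisPt_apply_three]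
  ring

/-- `H = M u/(u² + a²)` at the axis point `(t; 0, 0, u)`, `u > 0`. [folklore] -/
theorem scalarH_axisPt (M a t : ℝ) {u : ℝ} (hu : 0 < u) :
    Kerr.scalarH M a (E4.ofTimeSpace t (u • e_z)) = M * u / (u ^ 2 + a ^ 2) := by
  rw [Kerr.scalarH, radius_axisPt a t hu, ofTimeSpace_axisPt_apply_three]
  have h1 : u ^ 4 + a ^ 2 * u ^ 2 = u ^ 2 * (u ^ 2 + a ^ 2) := by ring
  have hu' : u ≠ 0 := hu.ne'
  have h2 : u ^ 2 + a ^ 2 ≠ 0 := by positivity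
  rw [h1]
  field_simp

/-- The constant axis covector `ℓ₀ = dt* + dz`: `ℓ₀(v) = v⁰ + v³`. [folklore] -/
theorem ell0_apply (v : E4) : ℓ₀ v = v 0 + v 3 := by
  simp [E4.covector_apply, Fin.sum_univ_four]

/-- `ℓ = (1, 0, 0, 1)` at the axis point. [folklore] -/
theorem nullCovectorFun_axisPt (a t : ℝ) {u : ℝ} (hu : 0 < u) :
    Kerr.nullCovectorFun a (E4.ofTimeSpace t (u • e_z)) = ![1, 0, 0, 1] := by
  rw [Kerr.nullCovectorFun, radius_axisPt a t hu, ofTimeSpace_axisPt_apply_one,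
    ofTimeSpace_axisPt_apply_two, ofTimeSpace_axisPt_apply_three]
  have hu' : u ≠ 0 := hu.ne'
  ext i
  fin_cases i <;> simp [hu']

/-- `ℓ = ℓ₀` at the axis point. [folklore] -/
theorem nullCovector_axisPt (a t : ℝ) {u : ℝ} (hu : 0 < u) :
    Kerr.nullCovector a (E4.ofTimeSpace t (u • e_z)) = ℓ₀ := by
  rw [Kerr.nullCovector, nullCovectorFun_axisPt a t hu]

/-- `ℓ♯ = −∂_{t*} + ∂_z` at the axis point. [folklore] -/
theorem nullVector_axisPt (a t : ℝ) {u : ℝ} (hu : 0 < u) :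
    Kerr.nullVector a (E4.ofTimeSpace t (u • e_z)) = -E4.basisVector 0 + E4.basisVector 3 := by
  ext μ
  rw [Kerr.nullVector_apply, nullCovectorFun_axisPt a t hu]
  fin_cases μ <;> simp [E4.basisVector]

/-- The axis profile `H_ax(u) = M u/(u² + a²)` of the Kerr–Schild scalar has derivative
`H_ax′(u) = M (a² − u²)/(u² + a²)²`. [folklore] -/
theorem hasDerivAt_Hax (M a : ℝ) {u : ℝ} (hu : 0 < u) :
    HasDerivAt (fun u : ℝ ↦ M * u / (u ^ 2 + a ^ 2)) (M * (a ^ 2 - u ^ 2) / (u ^ 2 + a ^ 2) ^ 2) u := by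
  have h1 : HasDerivAt (fun u : ℝ ↦ M * u) M u := by
    simpa using (hasDerivAt_id u).const_mul M
  have h2 : HasDerivAt (fun u : ℝ ↦ u ^ 2 + a ^ 2) (2 * u) u := by
    simpa using (hasDerivAt_pow 2 u).add_const (a ^ 2)
  have hne : u ^ 2 + a ^ 2 ≠ 0 := by positivity
  have h := h1.div h2 hne
  have heq : M * (a ^ 2 - u ^ 2) / (u ^ 2 + a ^ 2) ^ 2 =
      (M * (u ^ 2 + a ^ 2) - M * u * (2 * u)) / (u ^ 2 + a ^ 2) ^ 2 := by
    congr 1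
    ring
  rw [heq]
  exact h

/-- The metric components at the axis point: `g = η + 2 H_ax(u) ℓ₀ ⊗ ℓ₀`. [folklore] -/
theorem bilin_axisPt (M a t : ℝ) {u : ℝ} (hu : 0 < u) :
    Kerr.bilin M a (E4.ofTimeSpace t (u • e_z)) =
      Minkowski.bilin + (2 * (M * u / (u ^ 2 + a ^ 2))) • E4.tmul ℓ₀ ℓ₀ := by
  rw [Kerr.bilin, scalarH_axisPt M a t hu, nullCovector_axisPt a t hu]

/-- `V = (1 + 2H) ∂_{t*} − 2H ∂_z` at the axis point. [folklore] -/
theorem timeVector_axisPt (M a t : ℝ) {u : ℝ} (hu : 0 < u) :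
    Kerr.timeVector M a (E4.ofTimeSpace t (u • e_z)) =
      (1 + 2 * (M * u / (u ^ 2 + a ^ 2))) • E4.basisVector 0 -
        (2 * (M * u / (u ^ 2 + a ^ 2))) • E4.basisVector 3 := by
  rw [Kerr.timeVector, nullVector_axisPt a t hu, scalarH_axisPt M a t hu]
  module

/-- The axis line through `(0; 0, 0, u₀)` in the direction `∂_z`. [folklore] -/
theorem axis_line (u₀ s : ℝ) :
    E4.ofTimeSpace 0 (u₀ • e_z) + s • E4.basisVector 3 = E4.ofTimeSpace 0 ((u₀ + s) • e_z) := by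
  ext μ
  refine Fin.cases ?_ (fun j ↦ ?_) μ
  · simp [E4.basisVector]
  · rw [PiLp.add_apply, PiLp.smul_apply, E4.ofTimeSpace_apply_succ, E4.ofTimeSpace_apply_succ,
      axisPt_apply, axisPt_apply]
    fin_cases j <;> simp [E4.basisVector, Fin.succ]

/-- `(0, e_z) = ∂_z`. [folklore] -/
theorem ofTimeSpace_ez : E4.ofTimeSpace 0 e_z = E4.basisVector 3 := by
  ext μ
  refine Fin.cases ?_ (fun j ↦ ?_) μ
  · simp [E4.basisVector]
  · rw [E4.ofTimeSpace_apply_succ]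
    fin_cases j <;> simp [E4.basisVector, Fin.succ]

/-- **`∂_z g` on the axis**: `DG_{(0;0,0,u₀)}(∂_z) = 2 H_ax′(u₀) ℓ₀ ⊗ ℓ₀` — along the axis
`ℓ ≡ ℓ₀` is constant and `H = H_ax(z)`. [folklore] -/
theorem fderiv_bilin_axis_Z (M a : ℝ) {u₀ : ℝ} (hu₀ : 0 < u₀) :
    fderiv ℝ (Kerr.bilin M a) (E4.ofTimeSpace 0 (u₀ • e_z)) (E4.basisVector 3) =
      (2 * (M * (a ^ 2 - u₀ ^ 2) / (u₀ ^ 2 + a ^ 2) ^ 2)) • E4.tmul ℓ₀ ℓ₀ := by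
  set p := E4.ofTimeSpace 0 (u₀ • e_z) with hp
  have hr : 0 < Kerr.radius a p := by rw [hp, radius_axisPt a 0 hu₀]; exact hu₀
  have hd : DifferentiableAt ℝ (Kerr.bilin M a) p :=
    (Kerr.contDiffAt_bilin M a hr (n := 1)).differentiableAt one_ne_zero
  have h1 : HasLineDerivAt ℝ (Kerr.bilin M a) (fderiv ℝ (Kerr.bilin M a) p (E4.basisVector 3)) p
      (E4.basisVector 3) :=
    hd.hasFDerivAt.hasLineDerivAt _
  have h2 : HasLineDerivAt ℝ (Kerr.bilin M a)
      ((2 * (M * (a ^ 2 - u₀ ^ 2) / (u₀ ^ 2 + a ^ 2) ^ 2)) • E4.tmul ℓ₀ ℓ₀) p (E4.basisVector 3) := by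
    show HasDerivAt (fun s : ℝ ↦ Kerr.bilin M a (p + s • E4.basisVector 3)) _ 0
    have hev : (fun s : ℝ ↦ Kerr.bilin M a (p + s • E4.basisVector 3)) =ᶠ[𝓝 0]
        fun s ↦ Minkowski.bilin + (2 * (M * (u₀ + s) / ((u₀ + s) ^ 2 + a ^ 2))) • E4.tmul ℓ₀ ℓ₀ := by
      have hpos : ∀ᶠ s : ℝ in 𝓝 0, -u₀ < s := eventually_gt_nhds (by linarith)
      filter_upwards [hpos] with s hs
      have hs' : 0 < u₀ + s := by linarith
      rw [hp, axis_line, bilin_axisPt M a 0 hs']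
    have hH : HasDerivAt (fun s : ℝ ↦ M * (u₀ + s) / ((u₀ + s) ^ 2 + a ^ 2))
        (M * (a ^ 2 - u₀ ^ 2) / (u₀ ^ 2 + a ^ 2) ^ 2) 0 := by
      have e : u₀ + 0 = u₀ := add_zero u₀
      have h := (hasDerivAt_Hax M a (u := u₀ + 0) (by rw [e]; exact hu₀)).comp_const_add u₀ 0
      rw [e] at h
      exact h
    have h3 : HasDerivAt
        (fun s : ℝ ↦ Minkowski.bilin + (2 * (M * (u₀ + s) / ((u₀ + s) ^ 2 + a ^ 2))) • E4.tmul ℓ₀ ℓ₀)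
        ((2 * (M * (a ^ 2 - u₀ ^ 2) / (u₀ ^ 2 + a ^ 2) ^ 2)) • E4.tmul ℓ₀ ℓ₀) 0 := by
      have := ((hH.const_mul 2).smul_const (E4.tmul ℓ₀ ℓ₀)).const_add Minkowski.bilin
      simpa using this
    exact h3.congr_of_eventuallyEq hev
  exact h1.unique h2

/-- **`∂_{t*} g = 0`** at the axis point (stationarity, tree lemma). -/
theorem fderiv_bilin_axis_zero (M a : ℝ) {u₀ : ℝ} (hu₀ : 0 < u₀) :
    fderiv ℝ (Kerr.bilin M a) (E4.ofTimeSpace 0 (u₀ • e_z)) (E4.basisVector 0) = 0 := by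
  have hr : 0 < Kerr.radius a (E4.ofTimeSpace 0 (u₀ • e_z)) := by
    rw [radius_axisPt a 0 hu₀]; exact hu₀
  exact Kerr.fderiv_bilin_basisVector_zero M a
    ((Kerr.contDiffAt_bilin M a hr (n := 1)).differentiableAt one_ne_zero)


/-! ### The future unit normal of the Kerr–Schild slice `{t* = 0}`, general spin -/

/-! The representative `N(y) = (1 + 2H)^{-1/2} V(0, y)` of the future unit normal of the slice
`{t* = 0}` of Kerr `(M, a)` in ingoing Kerr–Schild coordinates (Cook 2000, §3.2.2: lapse
`α = (1 + 2H)^{-1/2}`, shift `βⁱ = 2Hℓⁱ/(1 + 2H)`) is written `νKS[M, a]` (local notation). -/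

/-- **Uniqueness of the future unit normal (any spin)**: at a point `x = (0, y)` with `r > 0`, a
vector `n` which is `g`-orthogonal to the slice directions `(0, w)`, unit timelike and in the
future cone of `V = −g♯dt*` IS `V/√(1 + 2H)`. Linear algebra: `n = αV + B` with `B` spatial,
`g(B, B) = g(n − αV, B) = 0`, and `g` is positive definite on spatial vectors
(`|B⃗|² + 2Hℓ(B)²`), so `B = 0`; unit length and the future condition pin `α`. [folklore] -/
theorem eq_normalRepA {M a : ℝ} (hM : 0 ≤ M) {y : E3}
    (hx : 0 < Kerr.radius a (E4.ofTimeSpace 0 y)) {n : E4}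
    (hn : ∀ w : E3, Kerr.bilin M a (E4.ofTimeSpace 0 y) n (E4.ofTimeSpace 0 w) = 0)
    (hu : Kerr.bilin M a (E4.ofTimeSpace 0 y) n n = -1)
    (hf : Kerr.bilin M a (E4.ofTimeSpace 0 y) (Kerr.timeVector M a (E4.ofTimeSpace 0 y)) n < 0) :
    n = (√(1 + 2 * Kerr.scalarH M a (E4.ofTimeSpace 0 y)))⁻¹ •
      Kerr.timeVector M a (E4.ofTimeSpace 0 y) := by
  set x : E4 := E4.ofTimeSpace 0 y with hxdef
  set H : ℝ := Kerr.scalarH M a x with hHdef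
  set V : E4 := Kerr.timeVector M a x with hVdef
  have hH : 0 ≤ H := Kerr.scalarH_nonneg hM a x
  have hV1 : ∀ w : E4, Kerr.bilin M a x V w = -w 0 := fun w ↦ Kerr.bilin_timeVector hx w
  have hV2 : Kerr.bilin M a x V V = -1 - 2 * H := Kerr.bilin_timeVector_timeVector hx
  have hV0 : V 0 = 1 + 2 * H := by have := hV1 V; rw [hV2] at this; linarith
  have h12 : (0 : ℝ) < 1 + 2 * H := by positivity
  set α : ℝ := n 0 / (1 + 2 * H) with hαdef
  set B : E4 := n - α • V with hBdef
  have hB0 : B 0 = 0 := by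
    simp only [hBdef, PiLp.sub_apply, PiLp.smul_apply, smul_eq_mul, hV0, hαdef]
    field_simp
    ring
  have hB : E4.ofTimeSpace 0 (E4.spatial B) = B := by
    have := E4.ofTimeSpace_time_spatial B
    rwa [E4.time_apply, hB0] at this
  -- `g(B, B) = 0`
  have hnB : Kerr.bilin M a x n B = 0 := by rw [← hB]; exact hn _
  have hVB : Kerr.bilin M a x V B = 0 := by rw [hV1, hB0, neg_zero]
  have hBB : Kerr.bilin M a x B B = 0 := by
    have e : Kerr.bilin M a x (n - α • V) B = 0 := by
      have h1 : Kerr.bilin M a x (n - α • V) B =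
          Kerr.bilin M a x n B - α * Kerr.bilin M a x V B := by
        simp only [map_sub, map_smul]
        rfl
      rw [h1, hnB, hVB]; ring
    rwa [← hBdef] at e
  -- positivity of `g` on the slice directions forces `B = 0`
  have hsum : ∑ i : Fin 3, B i.succ * B i.succ +
      2 * H * (Kerr.nullCovector a x B * Kerr.nullCovector a x B) = 0 := by
    rw [Kerr.bilin_apply, Minkowski.bilin_apply, hB0] at hBB
    simpa using hBB
  have hsq : ∑ i : Fin 3, B i.succ * B i.succ = 0 := by
    have h1 : 0 ≤ ∑ i : Fin 3, B i.succ * B i.succ :=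
      Finset.sum_nonneg fun i _ ↦ mul_self_nonneg _
    have h2 : 0 ≤ 2 * H * (Kerr.nullCovector a x B * Kerr.nullCovector a x B) := by
      have := mul_self_nonneg (Kerr.nullCovector a x B)
      positivity
    linarith
  have hBi : ∀ i : Fin 3, B i.succ = 0 := fun i ↦ by
    have := (Finset.sum_eq_zero_iff_of_nonneg (fun j _ ↦ mul_self_nonneg (B (Fin.succ j)))).1
      hsq i (Finset.mem_univ i)
    exact mul_self_eq_zero.1 this
  have hBzero : B = 0 := by
    ext μ
    refine Fin.cases ?_ (fun j ↦ ?_) μ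
    · simpa using hB0
    · simpa using hBi j
  have hnV : n = α • V := by
    have : n - α • V = 0 := hBzero
    exact sub_eq_zero.1 this
  -- unit length and future direction pin `α`
  have hαsq : α ^ 2 * (1 + 2 * H) = 1 := by
    rw [hnV] at hu
    simp only [map_smul, FunLike.coe_smul, Pi.smul_apply, smul_eq_mul, hV2] at hu
    nlinarith [hu]
  have hαpos : 0 < α := by
    rw [hnV] at hf
    simp only [map_smul, smul_eq_mul, hV2] at hf
    nlinarith [hf, h12]
  have hα : α = (√(1 + 2 * H))⁻¹ := by
    rw [← Real.sqrt_inv]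
    have : (1 + 2 * H)⁻¹ = α ^ 2 := by
      rw [eq_comm, ← one_div, eq_div_iff h12.ne']
      exact hαsq
    rw [this, Real.sqrt_sq hαpos.le]
  rw [hnV, hα]

/-- **Normality**: `g(N(y), (0, w)) = 0` at `(0, y)` (`g(V, ·) = −dt*`). [folklore] -/
theorem bilin_normalRepA_ofTimeSpace (M a : ℝ) {y : E3}
    (hx : 0 < Kerr.radius a (E4.ofTimeSpace 0 y)) (w : E3) :
    Kerr.bilin M a (E4.ofTimeSpace 0 y) ((√(1 + 2 * Kerr.scalarH M a (E4.ofTimeSpace 0 y)))⁻¹ •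
      Kerr.timeVector M a (E4.ofTimeSpace 0 y)) (E4.ofTimeSpace 0 w) = 0 := by
  rw [map_smul, FunLike.coe_smul, Pi.smul_apply, Kerr.bilin_timeVector hx,
    E4.ofTimeSpace_apply_zero, neg_zero, smul_zero]

/-- The unit normal representative is differentiable at the points of the slice (`M ≥ 0`). -/
theorem differentiableAt_normalRepA {M a : ℝ} (hM : 0 ≤ M) {y : E3}
    (hx : 0 < Kerr.radius a (E4.ofTimeSpace 0 y)) :
    DifferentiableAt ℝ νKS[M, a] y := by
  have he : ContDiff ℝ 1 (E4.ofTimeSpace 0) :=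
    contMDiff_iff_contDiff.1 (E4.contMDiff_ofTimeSpace 0 1)
  have hH : ContDiffAt ℝ 1 (fun y : E3 ↦ Kerr.scalarH M a (E4.ofTimeSpace 0 y)) y :=
    (Kerr.contDiffAt_scalarH M a hx).comp y he.contDiffAt
  have hV : ContDiffAt ℝ 1 (fun y : E3 ↦ Kerr.timeVector M a (E4.ofTimeSpace 0 y)) y :=
    (Kerr.contDiffAt_timeVector M a hx).comp y he.contDiffAt
  have hpos' : 0 < 1 + 2 * Kerr.scalarH M a (E4.ofTimeSpace 0 y) := by
    have := Kerr.scalarH_nonneg hM a (E4.ofTimeSpace 0 y); positivity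
  have hs : ContDiffAt ℝ 1
      (fun y : E3 ↦ (√(1 + 2 * Kerr.scalarH M a (E4.ofTimeSpace 0 y)))⁻¹) y := by
    refine ((contDiffAt_const.add (contDiffAt_const.mul hH)).sqrt hpos'.ne').inv ?_
    exact (Real.sqrt_pos.2 hpos').ne'
  exact (hs.smul hV).differentiableAt one_ne_zero

/-- **The derivative of the normality relation along the slice (any spin)**:
`g(DN(y) v, (0, w)) = −(∂_{(0,v)} g)(N(y), (0, w))` at `(0, y)` — differentiate
`y ↦ g_{(0,y)}(N(y), (0, w)) ≡ 0` (O'Neill 1983, Ch. 4, proof of Lemma 4.4). [folklore] -/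
theorem bilin_fderiv_normalRepA {M a : ℝ} (hM : 0 ≤ M) {y : E3}
    (hx : 0 < Kerr.radius a (E4.ofTimeSpace 0 y)) (v w : E3) :
    Kerr.bilin M a (E4.ofTimeSpace 0 y) (fderiv ℝ νKS[M, a] y v) (E4.ofTimeSpace 0 w) =
      -fderiv ℝ (Kerr.bilin M a) (E4.ofTimeSpace 0 y) (E4.ofTimeSpace 0 v)
        ((√(1 + 2 * Kerr.scalarH M a (E4.ofTimeSpace 0 y)))⁻¹ •
          Kerr.timeVector M a (E4.ofTimeSpace 0 y)) (E4.ofTimeSpace 0 w) := by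
  -- the function `y' ↦ g_{(0,y')}(N y', (0,w))` vanishes near `y`
  have ho : IsOpen {y' : E3 | 0 < Kerr.radius a (E4.ofTimeSpace 0 y')} :=
    isOpen_lt continuous_const ((Kerr.continuous_radius a).comp (E4.continuous_ofTimeSpace 0))
  have hzero : (fun y' : E3 ↦ Kerr.bilin M a (E4.ofTimeSpace 0 y') (νKS[M, a] y')
      (E4.ofTimeSpace 0 w)) =ᶠ[𝓝 y] fun _ ↦ 0 := by
    filter_upwards [ho.mem_nhds hx] with y' hy'
    exact bilin_normalRepA_ofTimeSpace M a hy' w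
  have h0 : HasFDerivAt (fun y' : E3 ↦ Kerr.bilin M a (E4.ofTimeSpace 0 y') (νKS[M, a] y')
      (E4.ofTimeSpace 0 w)) (0 : E3 →L[ℝ] ℝ) y :=
    (hasFDerivAt_const (0 : ℝ) y).congr_of_eventuallyEq hzero
  -- and its derivative by the product rule
  have hGd : DifferentiableAt ℝ (Kerr.bilin M a) (E4.ofTimeSpace 0 y) :=
    (Kerr.contDiffAt_bilin M a hx (n := 1)).differentiableAt one_ne_zero
  have hB : HasFDerivAt (fun y' : E3 ↦ Kerr.bilin M a (E4.ofTimeSpace 0 y'))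
      ((fderiv ℝ (Kerr.bilin M a) (E4.ofTimeSpace 0 y)).comp Kerr.sliceEmbedCLM) y :=
    hGd.hasFDerivAt.comp y (Kerr.hasFDerivAt_ofTimeSpace_zero y)
  have hN := (differentiableAt_normalRepA hM hx).hasFDerivAt
  have h1 := (hB.clm_apply hN).clm_apply (hasFDerivAt_const (E4.ofTimeSpace 0 w) y)
  have huniq := h0.unique h1
  have key := DFunLike.congr_fun huniq v
  simp only [zero_apply, _root_.add_apply,
    ContinuousLinearMap.comp_apply, ContinuousLinearMap.flip_apply, Kerr.sliceEmbedCLM_apply,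
    map_zero, zero_add] at key
  linarith

/-- At the axis point: `N = √(1 + 2H)⁻¹ ((1 + 2H) ∂_{t*} − 2H ∂_z)`, `H = H_ax(u)`. -/
theorem normalRepA_axisPt (M a : ℝ) {u : ℝ} (hu : 0 < u) :
    (√(1 + 2 * Kerr.scalarH M a (E4.ofTimeSpace 0 (u • e_z))))⁻¹ •
      Kerr.timeVector M a (E4.ofTimeSpace 0 (u • e_z)) = (√(1 + 2 * (M * u / (u ^ 2 + a ^ 2))))⁻¹ •
      ((1 + 2 * (M * u / (u ^ 2 + a ^ 2))) • E4.basisVector 0 -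
        (2 * (M * u / (u ^ 2 + a ^ 2))) • E4.basisVector 3) := by
  rw [timeVector_axisPt M a 0 hu, scalarH_axisPt M a 0 hu]


/-- `ℓ₀(∂_{t*}) = 1`. [folklore] -/
theorem ell0_basisVector_zero : ℓ₀ (E4.basisVector 0) = 1 := by
  rw [ell0_apply]; simp [E4.basisVector]

/-- `ℓ₀(∂_z) = 1`. [folklore] -/
theorem ell0_basisVector_three : ℓ₀ (E4.basisVector 3) = 1 := by
  rw [ell0_apply]; simp [E4.basisVector]

end Summit.FinalStateConjecture.FinalStateConjecture.Theorems.ParametricKerrBurial.Negative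

end
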